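import Mathlib
import HarnessLib
import Literature.Probability.MarkovChains.TotalVariation

/-!
# Distinguishing statistics: `|E_ν f − E_μ f| ≥ rσ⋆ ⇒ ‖μ − ν‖_TV ≥ 1 − 8/r²` (Levin–Peres–Wilmer, Proposition 7.9)

HONEST FRAMING: exact (Metropolis-corrected) sampling algorithms for lattice gauge theory; figures
of merit are autocorrelation/cost numbers at stated couplings and volumes; no continuum-physics claim.

Finite state space `X`, laws as vectors `X → ℝ`, `tvDist` of `TotalVariation.lean`.  Source:
D. A. Levin, Y. Peres (with E. L. Wilmer), *Markov Chains and Mixing Times*, 2nd ed., AMS 2017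
[LevinPeres2017], §7.3.  Everything is PROVED (finite sums; 0 named facts).

* `lawMean μ f = E_μ(f) = Σ_x f(x) μ(x)` and `lawVariance μ f = Var_μ(f)` [cite: LevinPeres2017,
  §7.3 (displays before Prop. 7.9)];
* `sum_filter_le_lawVariance_div_sq` — Chebyshev's inequality for a non-negative vector `μ`:
  `μ{x : a ≤ |f(x) − E_μ f|} ≤ Var_μ(f)/a²` [cite: LevinPeres2017, §7.3, proof of Prop. 7.9
  ("Chebyshev's inequality yields")];
* **PROPOSITION 7.9** `LevinPeres2017_prop_7_9`: for probability vectors `μ, ν`, a statistic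
  `f : X → ℝ` and `σ⋆² = max{Var_μ(f), Var_ν(f)}`: if `|E_ν(f) − E_μ(f)| ≥ rσ⋆` (`r > 0`) then
  `‖μ − ν‖_TV ≥ 1 − 8/r²` [cite: LevinPeres2017, §7.3 Prop. 7.9]; Markov-chain form
  `LevinPeres2017_prop_7_9_chain`: `|E_x f(X_t) − E_π(f)| ≥ rσ⋆ ⇒ ‖Pᵗ(x,·) − π‖_TV ≥ 1 − 8/r²`.
  SCOPE NOTE made explicit as a hypothesis: `σ⋆ > 0`.  (As printed the case `σ⋆ = 0`,
  `E_μ f = E_ν f` satisfies the hypothesis vacuously while the conclusion fails for `r² > 8`,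
  e.g. `μ = ν`; the printed proof divides by `σ⋆`.  With `σ⋆ > 0` the statement is exactly the
  printed one.)

Proof = the printed one, in vector form (no pushforward `μf⁻¹` / Lemma 7.10 needed on a finite
`X`): with `E_μ f ≤ E_ν f` and `A = {f > E_μ f + rσ⋆/2}`, Chebyshev gives `μ(A) ≤ 4/r²` and
`ν(A) ≥ 1 − 4/r²`, and the event form of total variation (`TotalVariation.sub_sum_le_tvDist`)
gives `‖μ − ν‖_TV ≥ ν(A) − μ(A)`.  Not here: Prop. 7.12* (the constant `1 − 4/(4 + r²)`).

Context (cell pub-lqcd, venture LatticeQCDFlow): the rigorous form of "an observable whose running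
mean is still `r` standard deviations from its equilibrium value certifies that the chain is not
mixed" (e.g. the topological charge under critical slowing down); companion of
`BottleneckRatio.lean` (Thm 7.4) among the Chapter-7 lower bounds.
-/

namespace Literature.Probability.MarkovChains

open Finset

variable {X : Type*} [Fintype X]

/-! ## Mean, variance, Chebyshev -/

/-- `E_μ(f) = Σ_x f(x) μ(x)`, the mean of the statistic `f` under the law `μ`.
[cite: LevinPeres2017, §7.3 (display before Prop. 7.9)] -/
def lawMean (μ : X → ℝ) (f : X → ℝ) : ℝ := ∑ x, μ x * f x

/-- `Var_μ(f) = Σ_x (f(x) − E_μ f)² μ(x)`, the variance of `f` under `μ`.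
[cite: LevinPeres2017, §7.3 (sentence before Prop. 7.9)] -/
def lawVariance (μ : X → ℝ) (f : X → ℝ) : ℝ := ∑ x, μ x * (f x - lawMean μ f) ^ 2

/-- `Var_μ(f) ≥ 0` for `μ ≥ 0`. [cite: LevinPeres2017, §7.3] -/
theorem lawVariance_nonneg {μ : X → ℝ} (hμ : ∀ x, 0 ≤ μ x) (f : X → ℝ) : 0 ≤ lawVariance μ f :=
  sum_nonneg fun x _ => mul_nonneg (hμ x) (sq_nonneg _)

/-- **Chebyshev's inequality** (finite form): for `μ ≥ 0` and `a > 0`,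
`μ{x : a ≤ |f(x) − E_μ f|} ≤ Var_μ(f)/a²`.
[cite: LevinPeres2017, §7.3, proof of Prop. 7.9 ("Chebyshev's inequality yields")] -/
theorem sum_filter_le_lawVariance_div_sq {μ : X → ℝ} (hμ : ∀ x, 0 ≤ μ x) (f : X → ℝ) {a : ℝ}
    (ha : 0 < a) :
    ∑ x ∈ univ.filter (fun x => a ≤ |f x - lawMean μ f|), μ x ≤ lawVariance μ f / a ^ 2 := by
  rw [le_div_iff₀ (pow_pos ha 2), sum_mul]
  calc ∑ x ∈ univ.filter (fun x => a ≤ |f x - lawMean μ f|), μ x * a ^ 2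
      ≤ ∑ x ∈ univ.filter (fun x => a ≤ |f x - lawMean μ f|), μ x * (f x - lawMean μ f) ^ 2 := by
        refine sum_le_sum fun x hx => mul_le_mul_of_nonneg_left ?_ (hμ x)
        have hax : a ≤ |f x - lawMean μ f| := (mem_filter.mp hx).2
        calc a ^ 2 ≤ |f x - lawMean μ f| ^ 2 := pow_le_pow_left₀ ha.le hax 2
          _ = (f x - lawMean μ f) ^ 2 := sq_abs _
    _ ≤ lawVariance μ f :=
        sum_le_sum_of_subset_of_nonneg (filter_subset _ _) fun x _ _ =>
          mul_nonneg (hμ x) (sq_nonneg _)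

/-! ## Proposition 7.9 -/

/-- The one-sided core of Prop. 7.9: if `E_μ f + rσ ≤ E_ν f` with `σ > 0`, `σ² ≥ Var_μ f`,
`σ² ≥ Var_ν f`, then `‖μ − ν‖_TV ≥ 1 − 8/r²` (Chebyshev on `A = {f > E_μ f + rσ/2}` under both
laws). [cite: LevinPeres2017, §7.3 Prop. 7.9 (proof)] -/
theorem one_sub_le_tvDist_of_lawMean_add_le {μ ν : X → ℝ} (hμ : ∀ x, 0 ≤ μ x)
    (hμ1 : ∑ x, μ x = 1) (hν : ∀ x, 0 ≤ ν x) (hν1 : ∑ x, ν x = 1) (f : X → ℝ) {r σ : ℝ}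
    (hr : 0 < r) (hσ : 0 < σ) (hσμ : lawVariance μ f ≤ σ ^ 2) (hσν : lawVariance ν f ≤ σ ^ 2)
    (h : lawMean μ f + r * σ ≤ lawMean ν f) : 1 - 8 / r ^ 2 ≤ tvDist μ ν := by
  classical
  set m := lawMean μ f with hm
  set A : Finset X := univ.filter (fun x => m + r * σ / 2 < f x) with hA
  have ha : 0 < r * σ / 2 := by positivity
  have hcheb : σ ^ 2 / (r * σ / 2) ^ 2 = 4 / r ^ 2 := by
    field_simp
    ring
  -- `μ(A) ≤ 4/r²`
  have hμA : ∑ x ∈ A, μ x ≤ 4 / r ^ 2 := by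
    calc ∑ x ∈ A, μ x ≤ ∑ x ∈ univ.filter (fun x => r * σ / 2 ≤ |f x - lawMean μ f|), μ x := by
          refine sum_le_sum_of_subset_of_nonneg (fun x hx => ?_) fun x _ _ => hμ x
          have hx' : m + r * σ / 2 < f x := (mem_filter.mp hx).2
          refine mem_filter.mpr ⟨mem_univ _, ?_⟩
          rw [← hm]
          exact le_trans (by linarith) (le_abs_self _)
      _ ≤ lawVariance μ f / (r * σ / 2) ^ 2 := sum_filter_le_lawVariance_div_sq hμ f ha
      _ ≤ σ ^ 2 / (r * σ / 2) ^ 2 := div_le_div_of_nonneg_right hσμ (by positivity)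
      _ = 4 / r ^ 2 := hcheb
  -- `ν(Aᶜ) ≤ 4/r²`
  have hνAc : ∑ x ∈ Aᶜ, ν x ≤ 4 / r ^ 2 := by
    calc ∑ x ∈ Aᶜ, ν x ≤ ∑ x ∈ univ.filter (fun x => r * σ / 2 ≤ |f x - lawMean ν f|), ν x := by
          refine sum_le_sum_of_subset_of_nonneg (fun x hx => ?_) fun x _ _ => hν x
          have hx' : ¬ (m + r * σ / 2 < f x) := fun h' => (mem_compl.mp hx) (mem_filter.mpr ⟨mem_univ _, h'⟩)
          refine mem_filter.mpr ⟨mem_univ _, ?_⟩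
          rw [abs_sub_comm]
          exact le_trans (by linarith) (le_abs_self _)
      _ ≤ lawVariance ν f / (r * σ / 2) ^ 2 := sum_filter_le_lawVariance_div_sq hν f ha
      _ ≤ σ ^ 2 / (r * σ / 2) ^ 2 := div_le_div_of_nonneg_right hσν (by positivity)
      _ = 4 / r ^ 2 := hcheb
  have hνA : 1 - 4 / r ^ 2 ≤ ∑ x ∈ A, ν x := by
    have := sum_add_sum_compl A ν
    linarith
  -- event form of total variation
  have hev : ∑ x ∈ A, ν x - ∑ x ∈ A, μ x ≤ tvDist ν μ :=
    sub_sum_le_tvDist (by rw [hν1, hμ1]) A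
  rw [tvDist_comm] at hev
  have h8 : (1 : ℝ) - 8 / r ^ 2 = (1 - 4 / r ^ 2) - 4 / r ^ 2 := by ring
  rw [h8]
  linarith

/-- **Proposition 7.9 (distinguishing statistic).**  For probability vectors `μ, ν` on a finite
`X`, a statistic `f : X → ℝ`, `σ⋆² = max{Var_μ(f), Var_ν(f)}` with `σ⋆ > 0`, and `r > 0`:
if `|E_ν(f) − E_μ(f)| ≥ r σ⋆` then `‖μ − ν‖_TV ≥ 1 − 8/r²`.  (`σ⋆ > 0` is the printed
statement's implicit non-degeneracy: see the module docstring.)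
[cite: LevinPeres2017, §7.3 Prop. 7.9] -/
theorem LevinPeres2017_prop_7_9 {μ ν : X → ℝ} (hμ : ∀ x, 0 ≤ μ x) (hμ1 : ∑ x, μ x = 1)
    (hν : ∀ x, 0 ≤ ν x) (hν1 : ∑ x, ν x = 1) (f : X → ℝ) {r : ℝ} (hr : 0 < r)
    (hσ : 0 < max (lawVariance μ f) (lawVariance ν f))
    (h : r * Real.sqrt (max (lawVariance μ f) (lawVariance ν f)) ≤ |lawMean ν f - lawMean μ f|) :
    1 - 8 / r ^ 2 ≤ tvDist μ ν := by
  set V := max (lawVariance μ f) (lawVariance ν f) with hV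
  set σ := Real.sqrt V with hσdef
  have hσpos : 0 < σ := Real.sqrt_pos.mpr hσ
  have hσsq : σ ^ 2 = V := Real.sq_sqrt hσ.le
  have hσμ : lawVariance μ f ≤ σ ^ 2 := hσsq ▸ le_max_left _ _
  have hσν : lawVariance ν f ≤ σ ^ 2 := hσsq ▸ le_max_right _ _
  rcases le_or_gt (lawMean μ f) (lawMean ν f) with hle | hlt
  · rw [abs_of_nonneg (by linarith)] at h
    exact one_sub_le_tvDist_of_lawMean_add_le hμ hμ1 hν hν1 f hr hσpos hσμ hσν (by linarith)
  · rw [abs_of_neg (by linarith)] at h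
    rw [tvDist_comm]
    exact one_sub_le_tvDist_of_lawMean_add_le hν hν1 hμ hμ1 f hr hσpos hσν hσμ (by linarith)

/-- **Proposition 7.9, Markov-chain form**: for a row-stochastic `P`, a probability vector `π`, a
state `x` and a time `t`: if `|E_x[f(X_t)] − E_π(f)| ≥ rσ⋆` with
`σ⋆² = max{Var_{Pᵗ(x,·)}(f), Var_π(f)} > 0`, `r > 0`, then `‖Pᵗ(x,·) − π‖_TV ≥ 1 − 8/r²`.
[cite: LevinPeres2017, §7.3 Prop. 7.9 ("In particular")] -/
theorem LevinPeres2017_prop_7_9_chain [DecidableEq X] {P : X → X → ℝ} (hP : IsRowStochastic P)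
    {π : X → ℝ} (hπ0 : ∀ x, 0 ≤ π x) (hπ1 : ∑ x, π x = 1) (x : X) (t : ℕ) (f : X → ℝ)
    {r : ℝ} (hr : 0 < r)
    (hσ : 0 < max (lawVariance (lawAt P (Pi.single x 1) t) f) (lawVariance π f))
    (h : r * Real.sqrt (max (lawVariance (lawAt P (Pi.single x 1) t) f) (lawVariance π f)) ≤
      |lawMean π f - lawMean (lawAt P (Pi.single x 1) t) f|) :
    1 - 8 / r ^ 2 ≤ tvDist (lawAt P (Pi.single x 1) t) π := by
  have h0 : ∀ z, 0 ≤ (Pi.single x (1 : ℝ) : X → ℝ) z := fun z => by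
    rw [Pi.single_apply]; split_ifs <;> norm_num
  have h1 : ∑ z, lawAt P (Pi.single x 1) t z = 1 := by
    rw [sum_lawAt hP, Finset.sum_pi_single']; simp
  exact LevinPeres2017_prop_7_9 (fun z => lawAt_nonneg hP h0 t z) h1 hπ0 hπ1 f hr hσ h

end Literature.Probability.MarkovChains
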